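import Mathlib
import HarnessLib

/-!
# `NoHeavyLowerTail` (stmt-CriticalPhenomena-4575) — two-port peeling, champion at a port: the certificate algebra (level `j ≤ 2`)

Route `PercNearOneGluingNoHeavy`, seat `prim-gen-swap` (gen 5); memo TWO-PORT-PEELING.md §9.  The champion-stability pair
inequality CS₂ for merging a two-port star `u = {c, a'}` whose port `c` is the champion with a second two-port star
`v = {b, b'}` reduces (slicing at `u`, comonotone coupling `θ_v = s` at `v`) to `E[Z] ≥ 0`,
`Z = (1 − a')·Y0 + a'·Ya'`.  This file proves the pointwise certificate
`Z − a'·K̂_{a'} − (s(1−a')/2)·(K_b + K_{b'}) ≥ 0`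
at level `j ≤ 2`, where `K̂_{a'}, K_b, K_{b'}` are the (sliced) champion rows, as a polynomial inequality in the bond
parameters `s, a', τ ∈ [0,1]` and eleven `0/1` indicators (`σ, α', β, β'` loneliness of `c, a', b, b'`; `β₂` the glued pair
`{b,b'}` is small; `γ₂` the glued pair `{c,a'}` is small; `κb, κb'` attachment of `c` to `b`, `b'`; `κ'` attachment of `a'` to
`{b,b'}`; `ε` attachment `c ∼ a'`; `lb, lb'` attachment of `b`, `b'` to `{c,a'}`) subject to the structural implications valid
for set partitions at level `2`.  Pure real arithmetic (case analysis of memo §9); no definitions, no named facts, no sorries.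
-/

namespace Summit.CriticalPhenomena.PercolationContinuityZ3.Theorems

namespace TwoPortPeeling

/-- A `0/1` real is in `[0,1]`. [folklore] -/
theorem zo_bounds {x : ℝ} (hx : x = 0 ∨ x = 1) : 0 ≤ x ∧ x ≤ 1 := by
  rcases hx with rfl | rfl <;> norm_num

/-- **Champion-at-a-port certificate, core inequality `Y0 ≥ (s/2)(K_b + K_{b'})` (level `j ≤ 2`).**
With `σ = [c lonely]`, `β, β'` loneliness of `b, b'`, `β₂ = [{b,b'} glued small]`, `γ₂ = [{c,a'} glued small]`,
`κb, κb' = [c ∼ b], [c ∼ b']`, `lb, lb' = [b ∼ c or a'], [b' ∼ c or a']` and the level-2 structure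
(`σ = 0 → γ₂ = 0`; `β₂ = 1 →` `β = β' = 1`, `κb = κb' = lb = lb' = 0`; `σ = 1 → κb = 1 →` `β = lb = 1`, `κb' = β₂ = γ₂ = 0`;
symmetrically for `κb'`):
`(1−s)σ + s(1−κb−κb')(σ−β₂) ≥ (s/2)(K_b + K_{b'})`,
`K_b = (1−τ)[(1−s)(σ−β) + s(σ(1−κb−κb') − β₂)] + τ[(1−s)(γ₂ − β(1−lb)) + s(γ₂ − β₂)]`.
[this file; memo TWO-PORT-PEELING.md §9] -/
theorem cport_core_nonneg (s τ : ℝ) (hs0 : 0 ≤ s) (hs1 : s ≤ 1) (hτ0 : 0 ≤ τ) (hτ1 : τ ≤ 1)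
    (σ β β' β₂ γ₂ κb κb' lb lb' : ℝ)
    (hσ : σ = 0 ∨ σ = 1) (hβ : β = 0 ∨ β = 1) (hβ' : β' = 0 ∨ β' = 1) (hβ₂ : β₂ = 0 ∨ β₂ = 1)
    (hγ₂ : γ₂ = 0 ∨ γ₂ = 1) (hκb : κb = 0 ∨ κb = 1) (hκb' : κb' = 0 ∨ κb' = 1)
    (hlb : lb = 0 ∨ lb = 1) (hlb' : lb' = 0 ∨ lb' = 1)
    (hσγ : σ = 0 → γ₂ = 0)
    (hB2 : β₂ = 1 → β = 1 ∧ β' = 1 ∧ κb = 0 ∧ κb' = 0 ∧ lb = 0 ∧ lb' = 0)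
    (hKB : σ = 1 → κb = 1 → β = 1 ∧ lb = 1 ∧ κb' = 0 ∧ β₂ = 0 ∧ γ₂ = 0)
    (hKB' : σ = 1 → κb' = 1 → β' = 1 ∧ lb' = 1 ∧ κb = 0 ∧ β₂ = 0 ∧ γ₂ = 0) :
    (s / 2) * (((1 - τ) * ((1 - s) * (σ - β) + s * (σ * (1 - (κb + κb')) - β₂)) +
          τ * ((1 - s) * (γ₂ - β * (1 - lb)) + s * (γ₂ - β₂))) +
        ((1 - τ) * ((1 - s) * (σ - β') + s * (σ * (1 - (κb + κb')) - β₂)) +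
          τ * ((1 - s) * (γ₂ - β' * (1 - lb')) + s * (γ₂ - β₂)))) ≤
      (1 - s) * σ + s * (1 - (κb + κb')) * (σ - β₂) := by
  obtain ⟨hb0, hb1⟩ := zo_bounds hβ
  obtain ⟨hb0', hb1'⟩ := zo_bounds hβ'
  obtain ⟨hg0, hg1⟩ := zo_bounds hγ₂
  obtain ⟨hl0, hl1⟩ := zo_bounds hlb
  obtain ⟨hl0', hl1'⟩ := zo_bounds hlb'
  have h1s : 0 ≤ 1 - s := sub_nonneg.2 hs1
  have h1τ : 0 ≤ 1 - τ := sub_nonneg.2 hτ1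
  rcases hσ with rfl | rfl
  · -- Case A: `c` is not lonely
    have hg : γ₂ = 0 := hσγ rfl
    subst hg
    rcases hβ₂ with rfl | rfl
    · -- β₂ = 0: both rows are ≤ 0
      have p1 : 0 ≤ s * (1 - s) * (β * ((1 - τ) + τ * (1 - lb))) :=
        mul_nonneg (mul_nonneg hs0 h1s) (mul_nonneg hb0 (add_nonneg h1τ (mul_nonneg hτ0 (sub_nonneg.2 hl1))))
      have p2 : 0 ≤ s * (1 - s) * (β' * ((1 - τ) + τ * (1 - lb'))) :=
        mul_nonneg (mul_nonneg hs0 h1s) (mul_nonneg hb0' (add_nonneg h1τ (mul_nonneg hτ0 (sub_nonneg.2 hl1'))))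
      nlinarith [p1, p2]
    · -- β₂ = 1: the tight pattern, equality
      obtain ⟨rfl, rfl, rfl, rfl, rfl, rfl⟩ := hB2 rfl
      nlinarith
  · -- `c` lonely
    rcases hκb with rfl | rfl
    · rcases hκb' with rfl | rfl
      · rcases hβ₂ with rfl | rfl
        · -- Case D: σ = 1, no attachment of c to b, b', glued pair {b,b'} big
          have q1 : 0 ≤ (s / 2) * ((1 - τ) * (1 - s) * β + τ * ((1 - s) * (1 - γ₂ + β * (1 - lb)) + s * (1 - γ₂))) :=
            mul_nonneg (by linarith) (add_nonneg (mul_nonneg (mul_nonneg h1τ h1s) hb0)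
              (mul_nonneg hτ0 (add_nonneg (mul_nonneg h1s (by nlinarith [mul_nonneg hb0 (sub_nonneg.2 hl1)]))
                (mul_nonneg hs0 (sub_nonneg.2 hg1)))))
          have q2 : 0 ≤ (s / 2) * ((1 - τ) * (1 - s) * β' + τ * ((1 - s) * (1 - γ₂ + β' * (1 - lb')) + s * (1 - γ₂))) :=
            mul_nonneg (by linarith) (add_nonneg (mul_nonneg (mul_nonneg h1τ h1s) hb0')
              (mul_nonneg hτ0 (add_nonneg (mul_nonneg h1s (by nlinarith [mul_nonneg hb0' (sub_nonneg.2 hl1')]))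
                (mul_nonneg hs0 (sub_nonneg.2 hg1)))))
          nlinarith [q1, q2, h1s]
        · -- Case C: glued pair {b,b'} small
          obtain ⟨rfl, rfl, -, -, rfl, rfl⟩ := hB2 rfl
          have q : 0 ≤ s * τ * (1 - γ₂) := mul_nonneg (mul_nonneg hs0 hτ0) (sub_nonneg.2 hg1)
          nlinarith [q, h1s]
      · -- Case B': c ∼ b'
        obtain ⟨rfl, rfl, -, rfl, rfl⟩ := hKB' rfl rfl
        have q1 : 0 ≤ (1 - s) * (1 - s / 2) := mul_nonneg h1s (by linarith)
        have q2 : 0 ≤ (1 - s) * (s / 2) * (τ + β * (1 - τ)) :=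
          mul_nonneg (mul_nonneg h1s (by linarith)) (add_nonneg hτ0 (mul_nonneg hb0 h1τ))
        have q3 : 0 ≤ (1 - s) * (s / 2) * (τ * (β * (1 - lb))) :=
          mul_nonneg (mul_nonneg h1s (by linarith)) (mul_nonneg hτ0 (mul_nonneg hb0 (sub_nonneg.2 hl1)))
        nlinarith [q1, q2, q3]
    · -- Case B: c ∼ b
      obtain ⟨rfl, rfl, rfl, rfl, rfl⟩ := hKB rfl rfl
      have q1 : 0 ≤ (1 - s) * (1 - s / 2) := mul_nonneg h1s (by linarith)
      have q2 : 0 ≤ (1 - s) * (s / 2) * (τ + β' * (1 - τ)) :=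
        mul_nonneg (mul_nonneg h1s (by linarith)) (add_nonneg hτ0 (mul_nonneg hb0' h1τ))
      have q3 : 0 ≤ (1 - s) * (s / 2) * (τ * (β' * (1 - lb'))) :=
        mul_nonneg (mul_nonneg h1s (by linarith)) (mul_nonneg hτ0 (mul_nonneg hb0' (sub_nonneg.2 hl1')))
      nlinarith [q1, q2, q3]

/-- **Champion-at-a-port certificate (pointwise, level `j ≤ 2`).**  With the indicators of `cport_core_nonneg` plus
`α' = [a' lonely]`, `κ' = [a' ∼ b or a' ∼ b']`, `ε = [c ∼ a']` and the extra structure `σ = 1 → ε = 1 → (α' = 1 ∧ κ' = κb + κb')`: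
`Z − a'·K̂_{a'} − (s(1−a')/2)(K_b + K_{b'}) ≥ 0`, where `Z = (1−a')Y0 + a'Ya'`,
`Y0 = (1−s)σ + s(1−κb−κb')(σ−β₂)`, `Ya' = (1−s)(σ−α') + sσ(1−κb−κb')(1−ε)`,
`K̂_{a'} = (1−s)(σ−α') + s(σ(1−κb−κb') − α'(1−κ'))`.  [this file; memo TWO-PORT-PEELING.md §9] -/
theorem cport_certificate_algebra (s ap τ : ℝ) (hs0 : 0 ≤ s) (hs1 : s ≤ 1) (hap0 : 0 ≤ ap) (hap1 : ap ≤ 1)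
    (hτ0 : 0 ≤ τ) (hτ1 : τ ≤ 1)
    (σ α' β β' β₂ γ₂ κb κb' κ' ε lb lb' : ℝ)
    (hσ : σ = 0 ∨ σ = 1) (hα' : α' = 0 ∨ α' = 1) (hβ : β = 0 ∨ β = 1) (hβ' : β' = 0 ∨ β' = 1)
    (hβ₂ : β₂ = 0 ∨ β₂ = 1) (hγ₂ : γ₂ = 0 ∨ γ₂ = 1) (hκb : κb = 0 ∨ κb = 1) (hκb' : κb' = 0 ∨ κb' = 1)
    (hκ' : κ' = 0 ∨ κ' = 1) (hε : ε = 0 ∨ ε = 1) (hlb : lb = 0 ∨ lb = 1) (hlb' : lb' = 0 ∨ lb' = 1)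
    (hσγ : σ = 0 → γ₂ = 0)
    (hEPS : σ = 1 → ε = 1 → α' = 1 ∧ κ' = κb + κb')
    (hB2 : β₂ = 1 → β = 1 ∧ β' = 1 ∧ κb = 0 ∧ κb' = 0 ∧ lb = 0 ∧ lb' = 0)
    (hKB : σ = 1 → κb = 1 → β = 1 ∧ lb = 1 ∧ κb' = 0 ∧ β₂ = 0 ∧ γ₂ = 0)
    (hKB' : σ = 1 → κb' = 1 → β' = 1 ∧ lb' = 1 ∧ κb = 0 ∧ β₂ = 0 ∧ γ₂ = 0) :
    0 ≤ ((1 - ap) * ((1 - s) * σ + s * (1 - (κb + κb')) * (σ - β₂)) +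
          ap * ((1 - s) * (σ - α') + s * (σ * (1 - (κb + κb')) * (1 - ε)))) -
        ap * ((1 - s) * (σ - α') + s * (σ * (1 - (κb + κb')) - α' * (1 - κ'))) -
        (s * (1 - ap) / 2) *
          (((1 - τ) * ((1 - s) * (σ - β) + s * (σ * (1 - (κb + κb')) - β₂)) +
              τ * ((1 - s) * (γ₂ - β * (1 - lb)) + s * (γ₂ - β₂))) +
            ((1 - τ) * ((1 - s) * (σ - β') + s * (σ * (1 - (κb + κb')) - β₂)) +
              τ * ((1 - s) * (γ₂ - β' * (1 - lb')) + s * (γ₂ - β₂)))) := by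
  have core := cport_core_nonneg s τ hs0 hs1 hτ0 hτ1 σ β β' β₂ γ₂ κb κb' lb lb' hσ hβ hβ' hβ₂ hγ₂ hκb hκb' hlb hlb'
    hσγ hB2 hKB hKB'
  -- the bracket `α'(1−κ') − σ(1−κb−κb')ε ≥ 0`
  have brk : 0 ≤ α' * (1 - κ') - σ * (1 - (κb + κb')) * ε := by
    obtain ⟨ha0, ha1⟩ := zo_bounds hα'
    obtain ⟨hk0, hk1⟩ := zo_bounds hκ'
    rcases hσ with rfl | rfl
    · nlinarith [mul_nonneg ha0 (sub_nonneg.2 hk1)]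
    · rcases hε with rfl | rfl
      · nlinarith [mul_nonneg ha0 (sub_nonneg.2 hk1)]
      · obtain ⟨rfl, hk⟩ := hEPS rfl rfl
        rw [hk]; norm_num
  have h1ap : 0 ≤ 1 - ap := sub_nonneg.2 hap1
  have t1 := mul_le_mul_of_nonneg_left core h1ap
  have t2 : 0 ≤ ap * s * (α' * (1 - κ') - σ * (1 - (κb + κb')) * ε) := mul_nonneg (mul_nonneg hap0 hs0) brk
  nlinarith [t1, t2]

/-- The same certificate in the form found by the LP (multiplied by `1 − τ`, with `K_{a'} = (1 − τ)·K̂_{a'}`):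
`(1−τ)·Z ≥ a'·K_{a'} + (1−τ)·(s(1−a')/2)·(K_b + K_{b'})`. [this file] -/
theorem cport_certificate_algebra' (s ap τ : ℝ) (hs0 : 0 ≤ s) (hs1 : s ≤ 1) (hap0 : 0 ≤ ap) (hap1 : ap ≤ 1)
    (hτ0 : 0 ≤ τ) (hτ1 : τ ≤ 1)
    (σ α' β β' β₂ γ₂ κb κb' κ' ε lb lb' : ℝ)
    (hσ : σ = 0 ∨ σ = 1) (hα' : α' = 0 ∨ α' = 1) (hβ : β = 0 ∨ β = 1) (hβ' : β' = 0 ∨ β' = 1)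
    (hβ₂ : β₂ = 0 ∨ β₂ = 1) (hγ₂ : γ₂ = 0 ∨ γ₂ = 1) (hκb : κb = 0 ∨ κb = 1) (hκb' : κb' = 0 ∨ κb' = 1)
    (hκ' : κ' = 0 ∨ κ' = 1) (hε : ε = 0 ∨ ε = 1) (hlb : lb = 0 ∨ lb = 1) (hlb' : lb' = 0 ∨ lb' = 1)
    (hσγ : σ = 0 → γ₂ = 0)
    (hEPS : σ = 1 → ε = 1 → α' = 1 ∧ κ' = κb + κb')
    (hB2 : β₂ = 1 → β = 1 ∧ β' = 1 ∧ κb = 0 ∧ κb' = 0 ∧ lb = 0 ∧ lb' = 0)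
    (hKB : σ = 1 → κb = 1 → β = 1 ∧ lb = 1 ∧ κb' = 0 ∧ β₂ = 0 ∧ γ₂ = 0)
    (hKB' : σ = 1 → κb' = 1 → β' = 1 ∧ lb' = 1 ∧ κb = 0 ∧ β₂ = 0 ∧ γ₂ = 0) :
    ap * ((1 - τ) * ((1 - s) * (σ - α') + s * (σ * (1 - (κb + κb')) - α' * (1 - κ')))) +
        (1 - τ) * (s * (1 - ap) / 2) *
          (((1 - τ) * ((1 - s) * (σ - β) + s * (σ * (1 - (κb + κb')) - β₂)) +
              τ * ((1 - s) * (γ₂ - β * (1 - lb)) + s * (γ₂ - β₂))) +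
            ((1 - τ) * ((1 - s) * (σ - β') + s * (σ * (1 - (κb + κb')) - β₂)) +
              τ * ((1 - s) * (γ₂ - β' * (1 - lb')) + s * (γ₂ - β₂)))) ≤
      (1 - τ) * ((1 - ap) * ((1 - s) * σ + s * (1 - (κb + κb')) * (σ - β₂)) +
          ap * ((1 - s) * (σ - α') + s * (σ * (1 - (κb + κb')) * (1 - ε)))) := by
  have h := cport_certificate_algebra s ap τ hs0 hs1 hap0 hap1 hτ0 hτ1 σ α' β β' β₂ γ₂ κb κb' κ' ε lb lb' hσ hα' hβ hβ'
    hβ₂ hγ₂ hκb hκb' hκ' hε hlb hlb' hσγ hEPS hB2 hKB hKB'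
  have h1τ : 0 ≤ 1 - τ := sub_nonneg.2 hτ1
  nlinarith [mul_nonneg h1τ h]

/-- Product form of `cport_core_nonneg`: the attachment factor written `(1−κb)(1−κb')` (the literal indicator of
`¬(c ∼ b) ∧ ¬(c ∼ b')`) instead of `1 − κb − κb'`.
With `σ = [c lonely]`, `β, β'` loneliness of `b, b'`, `β₂ = [{b,b'} glued small]`, `γ₂ = [{c,a'} glued small]`,
`κb, κb' = [c ∼ b], [c ∼ b']`, `lb, lb' = [b ∼ c or a'], [b' ∼ c or a']` and the level-2 structure
(`σ = 0 → γ₂ = 0`; `β₂ = 1 →` `β = β' = 1`, `κb = κb' = lb = lb' = 0`; `σ = 1 → κb = 1 →` `β = lb = 1`, `κb' = β₂ = γ₂ = 0`;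
symmetrically for `κb'`):
[this file] -/
theorem cport_core_nonneg_prod (s τ : ℝ) (hs0 : 0 ≤ s) (hs1 : s ≤ 1) (hτ0 : 0 ≤ τ) (hτ1 : τ ≤ 1)
    (σ β β' β₂ γ₂ κb κb' lb lb' : ℝ)
    (hσ : σ = 0 ∨ σ = 1) (hβ : β = 0 ∨ β = 1) (hβ' : β' = 0 ∨ β' = 1) (hβ₂ : β₂ = 0 ∨ β₂ = 1)
    (hγ₂ : γ₂ = 0 ∨ γ₂ = 1) (hκb : κb = 0 ∨ κb = 1) (hκb' : κb' = 0 ∨ κb' = 1)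
    (hlb : lb = 0 ∨ lb = 1) (hlb' : lb' = 0 ∨ lb' = 1)
    (hσγ : σ = 0 → γ₂ = 0)
    (hB2 : β₂ = 1 → β = 1 ∧ β' = 1 ∧ κb = 0 ∧ κb' = 0 ∧ lb = 0 ∧ lb' = 0)
    (hKB : σ = 1 → κb = 1 → β = 1 ∧ lb = 1 ∧ κb' = 0 ∧ β₂ = 0 ∧ γ₂ = 0)
    (hKB' : σ = 1 → κb' = 1 → β' = 1 ∧ lb' = 1 ∧ κb = 0 ∧ β₂ = 0 ∧ γ₂ = 0) :
    (s / 2) * (((1 - τ) * ((1 - s) * (σ - β) + s * (σ * ((1 - κb) * (1 - κb')) - β₂)) +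
          τ * ((1 - s) * (γ₂ - β * (1 - lb)) + s * (γ₂ - β₂))) +
        ((1 - τ) * ((1 - s) * (σ - β') + s * (σ * ((1 - κb) * (1 - κb')) - β₂)) +
          τ * ((1 - s) * (γ₂ - β' * (1 - lb')) + s * (γ₂ - β₂)))) ≤
      (1 - s) * σ + s * ((1 - κb) * (1 - κb')) * (σ - β₂) := by
  obtain ⟨hb0, hb1⟩ := zo_bounds hβ
  obtain ⟨hb0', hb1'⟩ := zo_bounds hβ'
  obtain ⟨hg0, hg1⟩ := zo_bounds hγ₂
  obtain ⟨hl0, hl1⟩ := zo_bounds hlb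
  obtain ⟨hl0', hl1'⟩ := zo_bounds hlb'
  have h1s : 0 ≤ 1 - s := sub_nonneg.2 hs1
  have h1τ : 0 ≤ 1 - τ := sub_nonneg.2 hτ1
  rcases hσ with rfl | rfl
  · -- Case A: `c` is not lonely
    have hg : γ₂ = 0 := hσγ rfl
    subst hg
    rcases hβ₂ with rfl | rfl
    · -- β₂ = 0: both rows are ≤ 0
      have p1 : 0 ≤ s * (1 - s) * (β * ((1 - τ) + τ * (1 - lb))) :=
        mul_nonneg (mul_nonneg hs0 h1s) (mul_nonneg hb0 (add_nonneg h1τ (mul_nonneg hτ0 (sub_nonneg.2 hl1))))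
      have p2 : 0 ≤ s * (1 - s) * (β' * ((1 - τ) + τ * (1 - lb'))) :=
        mul_nonneg (mul_nonneg hs0 h1s) (mul_nonneg hb0' (add_nonneg h1τ (mul_nonneg hτ0 (sub_nonneg.2 hl1'))))
      nlinarith [p1, p2]
    · -- β₂ = 1: the tight pattern, equality
      obtain ⟨rfl, rfl, rfl, rfl, rfl, rfl⟩ := hB2 rfl
      nlinarith
  · -- `c` lonely
    rcases hκb with rfl | rfl
    · rcases hκb' with rfl | rfl
      · rcases hβ₂ with rfl | rfl
        · -- Case D: σ = 1, no attachment of c to b, b', glued pair {b,b'} big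
          have q1 : 0 ≤ (s / 2) * ((1 - τ) * (1 - s) * β + τ * ((1 - s) * (1 - γ₂ + β * (1 - lb)) + s * (1 - γ₂))) :=
            mul_nonneg (by linarith) (add_nonneg (mul_nonneg (mul_nonneg h1τ h1s) hb0)
              (mul_nonneg hτ0 (add_nonneg (mul_nonneg h1s (by nlinarith [mul_nonneg hb0 (sub_nonneg.2 hl1)]))
                (mul_nonneg hs0 (sub_nonneg.2 hg1)))))
          have q2 : 0 ≤ (s / 2) * ((1 - τ) * (1 - s) * β' + τ * ((1 - s) * (1 - γ₂ + β' * (1 - lb')) + s * (1 - γ₂))) :=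
            mul_nonneg (by linarith) (add_nonneg (mul_nonneg (mul_nonneg h1τ h1s) hb0')
              (mul_nonneg hτ0 (add_nonneg (mul_nonneg h1s (by nlinarith [mul_nonneg hb0' (sub_nonneg.2 hl1')]))
                (mul_nonneg hs0 (sub_nonneg.2 hg1)))))
          nlinarith [q1, q2, h1s]
        · -- Case C: glued pair {b,b'} small
          obtain ⟨rfl, rfl, -, -, rfl, rfl⟩ := hB2 rfl
          have q : 0 ≤ s * τ * (1 - γ₂) := mul_nonneg (mul_nonneg hs0 hτ0) (sub_nonneg.2 hg1)
          nlinarith [q, h1s]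
      · -- Case B': c ∼ b'
        obtain ⟨rfl, rfl, -, rfl, rfl⟩ := hKB' rfl rfl
        have q1 : 0 ≤ (1 - s) * (1 - s / 2) := mul_nonneg h1s (by linarith)
        have q2 : 0 ≤ (1 - s) * (s / 2) * (τ + β * (1 - τ)) :=
          mul_nonneg (mul_nonneg h1s (by linarith)) (add_nonneg hτ0 (mul_nonneg hb0 h1τ))
        have q3 : 0 ≤ (1 - s) * (s / 2) * (τ * (β * (1 - lb))) :=
          mul_nonneg (mul_nonneg h1s (by linarith)) (mul_nonneg hτ0 (mul_nonneg hb0 (sub_nonneg.2 hl1)))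
        nlinarith [q1, q2, q3]
    · -- Case B: c ∼ b
      obtain ⟨rfl, rfl, rfl, rfl, rfl⟩ := hKB rfl rfl
      have q1 : 0 ≤ (1 - s) * (1 - s / 2) := mul_nonneg h1s (by linarith)
      have q2 : 0 ≤ (1 - s) * (s / 2) * (τ + β' * (1 - τ)) :=
        mul_nonneg (mul_nonneg h1s (by linarith)) (add_nonneg hτ0 (mul_nonneg hb0' h1τ))
      have q3 : 0 ≤ (1 - s) * (s / 2) * (τ * (β' * (1 - lb'))) :=
        mul_nonneg (mul_nonneg h1s (by linarith)) (mul_nonneg hτ0 (mul_nonneg hb0' (sub_nonneg.2 hl1')))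
      nlinarith [q1, q2, q3]

/-- **Champion-at-a-port certificate, product/indicator form (pointwise, level `j ≤ 2`).**  As
`cport_certificate_algebra`, with the attachment factor `(1−κb)(1−κb')` and the pendant-world term written with the
literal indicator factor `(1−ε)`: `Ya' = (1−s)(1−ε)(σ−α') + s(1−ε)(1−κb)(1−κb')σ`; extra structure `ε = 1 → σ = α'`
(`c ∼ a'` makes `c` and `a'` equally lonely).  [this file; memo TWO-PORT-PEELING.md §9] -/
theorem cport_certificate_algebra_prod (s ap τ : ℝ) (hs0 : 0 ≤ s) (hs1 : s ≤ 1) (hap0 : 0 ≤ ap) (hap1 : ap ≤ 1)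
    (hτ0 : 0 ≤ τ) (hτ1 : τ ≤ 1)
    (σ α' β β' β₂ γ₂ κb κb' κ' ε lb lb' : ℝ)
    (hσ : σ = 0 ∨ σ = 1) (hα' : α' = 0 ∨ α' = 1) (hβ : β = 0 ∨ β = 1) (hβ' : β' = 0 ∨ β' = 1)
    (hβ₂ : β₂ = 0 ∨ β₂ = 1) (hγ₂ : γ₂ = 0 ∨ γ₂ = 1) (hκb : κb = 0 ∨ κb = 1) (hκb' : κb' = 0 ∨ κb' = 1)
    (hκ' : κ' = 0 ∨ κ' = 1) (hε : ε = 0 ∨ ε = 1) (hlb : lb = 0 ∨ lb = 1) (hlb' : lb' = 0 ∨ lb' = 1)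
    (hσγ : σ = 0 → γ₂ = 0)
    (hEPS : σ = 1 → ε = 1 → α' = 1 ∧ κ' = κb + κb')
    (hEPS2 : ε = 1 → σ = α')
    (hB2 : β₂ = 1 → β = 1 ∧ β' = 1 ∧ κb = 0 ∧ κb' = 0 ∧ lb = 0 ∧ lb' = 0)
    (hKB : σ = 1 → κb = 1 → β = 1 ∧ lb = 1 ∧ κb' = 0 ∧ β₂ = 0 ∧ γ₂ = 0)
    (hKB' : σ = 1 → κb' = 1 → β' = 1 ∧ lb' = 1 ∧ κb = 0 ∧ β₂ = 0 ∧ γ₂ = 0) :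
    0 ≤ ((1 - ap) * ((1 - s) * σ + s * ((1 - κb) * (1 - κb')) * (σ - β₂)) +
          ap * ((1 - s) * ((1 - ε) * (σ - α')) + s * (σ * ((1 - κb) * (1 - κb')) * (1 - ε)))) -
        ap * ((1 - s) * (σ - α') + s * (σ * ((1 - κb) * (1 - κb')) - α' * (1 - κ'))) -
        (s * (1 - ap) / 2) *
          (((1 - τ) * ((1 - s) * (σ - β) + s * (σ * ((1 - κb) * (1 - κb')) - β₂)) +
              τ * ((1 - s) * (γ₂ - β * (1 - lb)) + s * (γ₂ - β₂))) +
            ((1 - τ) * ((1 - s) * (σ - β') + s * (σ * ((1 - κb) * (1 - κb')) - β₂)) +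
              τ * ((1 - s) * (γ₂ - β' * (1 - lb')) + s * (γ₂ - β₂)))) := by
  have core := cport_core_nonneg_prod s τ hs0 hs1 hτ0 hτ1 σ β β' β₂ γ₂ κb κb' lb lb' hσ hβ hβ' hβ₂ hγ₂ hκb hκb' hlb hlb'
    hσγ hB2 hKB hKB'
  -- the pendant-world bracket `Ya' − K̂ = −(1−s)ε(σ−α') + s((1−κ')α' − ε(1−κb)(1−κb')σ) ≥ 0`
  have brk : 0 ≤ -((1 - s) * (ε * (σ - α'))) + s * (α' * (1 - κ') - ε * ((1 - κb) * (1 - κb')) * σ) := by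
    obtain ⟨ha0, ha1⟩ := zo_bounds hα'
    obtain ⟨hk0, hk1⟩ := zo_bounds hκ'
    rcases hε with rfl | rfl
    · nlinarith [mul_nonneg hs0 (mul_nonneg ha0 (sub_nonneg.2 hk1))]
    · have hsa : σ = α' := hEPS2 rfl
      rcases hσ with rfl | rfl
      · rw [← hsa]; norm_num
      · obtain ⟨ha, hk⟩ := hEPS rfl rfl
        rcases hκb with rfl | rfl
        · rcases hκb' with rfl | rfl
          · rw [← hsa, hk]; norm_num
          · rw [← hsa, hk]; norm_num
        · obtain ⟨-, -, hkb', -, -⟩ := hKB rfl rfl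
          rw [← hsa, hk, hkb']; norm_num
  have h1ap : 0 ≤ 1 - ap := sub_nonneg.2 hap1
  have t1 := mul_le_mul_of_nonneg_left core h1ap
  have t2 : 0 ≤ ap * (-((1 - s) * (ε * (σ - α'))) + s * (α' * (1 - κ') - ε * ((1 - κb) * (1 - κb')) * σ)) :=
    mul_nonneg hap0 brk
  nlinarith [t1, t2]

end TwoPortPeeling

end Summit.CriticalPhenomena.PercolationContinuityZ3.Theorems
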